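import Literature.MathematicalPhysics.QuantumLattice.GrassmannLaplacianGramBound
import Mathlib.Analysis.InnerProductSpace.PiL2
import HarnessLib

/-!
# The Gram–Hadamard bound for LINE DETERMINANTS between two clusters of fields, with mixed charges and
# row-dependent covariances

Topic `Literature/MathematicalPhysics/QuantumLattice`; a corollary of `GrassmannLaplacianGramBound.norm_gaussExpect_genProd_le`
(Feldman–Knörrer–Trubowitz 2004, App. B; Benfatto–Giuliani–Mastropietro 2006, (2.80)).  In the single-scale step of a fermionic
renormalisation group the `k`-line terms between two vertices `a`, `b` carry, after antisymmetrisation in the legs of `b`, the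
LINE DETERMINANT `det [A_{τ(i)}(X_i, Y_l)]_{i,l<k}` — row `i` = the `i`-th contracted leg `X_i` of `a`, column `l` = the `l`-th
contracted leg `Y_l` of `b`, `A_s = contr C_s` the two-point function of the covariance `C_s` carried by line `i` (`τ(i) = s`; e.g.
the soft covariances of two consecutive scales).  The legs have ARBITRARY charges.  PROVED here:

* **`norm_det_contr_le_of_gram`** — if every `C_s` is charged for one charge map `q` (`q X = q Y → C_s X Y = 0`) and its two-point
  function is in Gram form on the mixed pairs, `contr C_s X Y = ⟪f_s X, g_s Y⟫` (`q X`, `¬ q Y`) with `‖f_s X‖, ‖g_s Y‖ ≤ κ_s`, then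
  for EVERY `n`, every row assignment `τ : Fin n → ι` and all leg strings `X, Y : Fin n → Γ`,
  `‖det [contr C_{τ i} (X i) (Y l)]‖ ≤ (Σ_s κ_s²)^n` — no factorial in `n` (the Pauli principle for the loop lines), no condition on the
  charges of the legs (wrongly charged entries vanish), and the covariances may differ from row to row.

Proof: the determinant is a Gaussian expectation.  On the label set `Γ × Option ι` put the legs of `a` carried by line family `s` in
copy `some s` and the legs of `b` in copy `none`, and let `C̃` pair copy `some s` with copy `none` through `C_s` and nothing else; then
`contr C̃ ((X, some s), (Y, none)) = contr C_s X Y`, the copies `some _` do not contract among themselves, so the block determinant rule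
`gaussExpect_genProd_mul_genProd` gives `det = ± ∫ dμ_{C̃} ψ(X̃) ψ(Ỹ)`; and `C̃` is charged for `q ∘ fst` with Gram vectors in
`ℓ²(ι × Fin 2; E)` (the copy is encoded in the component: `f̃ (X, some s) = e_{(s,0)} ⊗ f_s X`, `g̃ (Y, none) = Σ_s e_{(s,0)} ⊗ g_s Y`,
`f̃ (Y, none) = Σ_s e_{(s,1)} ⊗ f_s Y`, `g̃ (X, some s) = e_{(s,1)} ⊗ g_s X`), all of norm `≤ (Σ_s κ_s²)^{1/2}`, whence
`norm_gaussExpect_genProd_le`.  Generic (`𝕜 = ℝ, ℂ`, any inner product space `E`, finite `Γ`, `ι`); no definitions, no named facts; the entries of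
`contr C̃` are private plumbing.

## Sources

J. Feldman, H. Knörrer, E. Trubowitz, Commun. Math. Phys. 247 (2004) 195–242, App. B (`FeldmanKnorrerTrubowitz2004`);
*Fermionic Functional Integrals and the Renormalization Group* (AMS 2002), §I.3 (`FeldmanKnorrerTrubowitz2002`);
G. Benfatto, A. Giuliani, V. Mastropietro, Ann. Henri Poincaré 7 (2006) 809–898, §2.8 (2.80) (`BenfattoGiulianiMastropietro2006`).
-/

noncomputable section

namespace Literature.MathematicalPhysics.QuantumLattice

open GrassmannAlgebra Matrix Finset
open scoped InnerProductSpace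

section LineDeterminant

variable {𝕜 : Type*} [RCLike 𝕜] {E : Type*} [NormedAddCommGroup E] [InnerProductSpace 𝕜 E]
variable {Γ : Type*} [Fintype Γ] [DecidableEq Γ] {ι : Type*} [Fintype ι] [DecidableEq ι]

omit [Fintype Γ] [DecidableEq Γ] [Fintype ι] [DecidableEq ι] in
/-- The two-point function of the LINE COVARIANCE `C̃` on `Γ × Option ι` (copy `some s` ↔ copy `none` through `C_s`) between a leg in
copy `some s` and a leg in copy `none` is `contr C_s`. [folklore] -/
private theorem contr_lineCov_some_none (C : ι → Matrix Γ Γ 𝕜) (s : ι) (X Y : Γ) :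
    contr 𝕜 (Matrix.of fun p p' : Γ × Option ι =>
        Option.elim p.2 (Option.elim p'.2 0 fun t => C t p.1 p'.1) fun t => Option.elim p'.2 (C t p.1 p'.1) fun _ => 0)
      (X, some s) (Y, none) = contr 𝕜 (C s) X Y := by
  simp only [contr_apply, Matrix.of_apply, Option.elim_none, Option.elim_some]

omit [Fintype Γ] [DecidableEq Γ] [Fintype ι] [DecidableEq ι] in
/-- … between a leg in copy `none` and a leg in copy `some s` it is `contr C_s` with the arguments in the same order. [folklore] -/
private theorem contr_lineCov_none_some (C : ι → Matrix Γ Γ 𝕜) (s : ι) (X Y : Γ) :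
    contr 𝕜 (Matrix.of fun p p' : Γ × Option ι =>
        Option.elim p.2 (Option.elim p'.2 0 fun t => C t p.1 p'.1) fun t => Option.elim p'.2 (C t p.1 p'.1) fun _ => 0)
      (X, none) (Y, some s) = contr 𝕜 (C s) X Y := by
  simp only [contr_apply, Matrix.of_apply, Option.elim_none, Option.elim_some]

omit [Fintype Γ] [DecidableEq Γ] [Fintype ι] [DecidableEq ι] in
/-- … and two legs in copies `some s`, `some t` do not contract. [folklore] -/
private theorem contr_lineCov_some_some (C : ι → Matrix Γ Γ 𝕜) (s t : ι) (X Y : Γ) :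
    contr 𝕜 (Matrix.of fun p p' : Γ × Option ι =>
        Option.elim p.2 (Option.elim p'.2 0 fun t => C t p.1 p'.1) fun t => Option.elim p'.2 (C t p.1 p'.1) fun _ => 0)
      (X, some s) (Y, some t) = 0 := by
  simp only [contr_apply, Matrix.of_apply, Option.elim_some, sub_self, mul_zero]

omit [Fintype Γ] [DecidableEq Γ] [Fintype ι] [DecidableEq ι] in
/-- … nor do two legs in copy `none`. [folklore] -/
private theorem contr_lineCov_none_none (C : ι → Matrix Γ Γ 𝕜) (X Y : Γ) :
    contr 𝕜 (Matrix.of fun p p' : Γ × Option ι =>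
        Option.elim p.2 (Option.elim p'.2 0 fun t => C t p.1 p'.1) fun t => Option.elim p'.2 (C t p.1 p'.1) fun _ => 0)
      (X, none) (Y, none) = 0 := by
  simp only [contr_apply, Matrix.of_apply, Option.elim_none, sub_self, mul_zero]

/-- **The line determinant is a Gaussian expectation**: with the line covariance `C̃` on `Γ × Option ι`,
`det [contr C_{τ i} (X i) (Y l)]_{i,l<n} = (−1)^{n(n−1)/2} · ∫ dμ_{C̃} ψ(X₀, some τ₀)⋯ψ(X_{n−1}, some τ_{n−1}) ψ(Y₀, none)⋯ψ(Y_{n−1}, none)`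
(Gaussian Grassmann integrals of balanced monomials are determinants of the two-point function).
[cite: FeldmanKnorrerTrubowitz2002, §I.3 (Gaussian Grassmann integrals are determinants)] -/
theorem det_contr_eq_gaussExpect_lineCov (C : ι → Matrix Γ Γ 𝕜) {n : ℕ} (τ : Fin n → ι) (X Y : Fin n → Γ) :
    (Matrix.of fun i l => contr 𝕜 (C (τ i)) (X i) (Y l)).det =
      (-1 : 𝕜) ^ (n.choose 2) * gaussExpect 𝕜 (Matrix.of fun p p' : Γ × Option ι =>
        Option.elim p.2 (Option.elim p'.2 0 fun t => C t p.1 p'.1) fun t => Option.elim p'.2 (C t p.1 p'.1) fun _ => 0)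
        (genProd 𝕜 (Fin.append (fun i => (X i, some (τ i))) (fun l => (Y l, (none : Option ι))))) := by
  rw [genProd_append, gaussExpect_genProd_mul_genProd 𝕜 _ (fun i => (X i, some (τ i))) (fun l => (Y l, (none : Option ι)))
    fun i j => contr_lineCov_some_some C _ _ _ _, ← mul_assoc, ← pow_add, ← two_mul, pow_mul, neg_one_sq, one_pow, one_mul]
  congr 2

omit [DecidableEq ι] in
/-- Sums of squares of norms bounded termwise. [folklore] -/
private theorem sum_ite_norm_sq_le {κ : ι → ℝ} (v : ι → E) (hv : ∀ s, ‖v s‖ ≤ κ s) :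
    ∑ s, ‖v s‖ ^ 2 ≤ ∑ s, κ s ^ 2 :=
  sum_le_sum fun s _ => pow_le_pow_left₀ (norm_nonneg _) (hv s) 2

omit [Fintype Γ] [DecidableEq Γ] [DecidableEq ι] in
/-- A single square of a norm is bounded by the sum of the squares of the bounds. [folklore] -/
private theorem norm_sq_le_sum_sq {κ : ι → ℝ} (s : ι) {x : E} (hx : ‖x‖ ≤ κ s) : ‖x‖ ^ 2 ≤ ∑ t, κ t ^ 2 :=
  (pow_le_pow_left₀ (norm_nonneg _) hx 2).trans (single_le_sum (f := fun t => κ t ^ 2) (fun t _ => sq_nonneg (κ t)) (mem_univ s))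

/-- **Gram–Hadamard for line determinants** (Feldman–Knörrer–Trubowitz 2004, App. B; Benfatto–Giuliani–Mastropietro 2006, (2.80)):
for charged covariances `C_s` (`q X = q Y → C_s X Y = 0`) whose two-point functions are in Gram form on the mixed pairs,
`contr C_s X Y = ⟪f_s X, g_s Y⟫` for `q X`, `¬ q Y`, with `‖f_s X‖, ‖g_s Y‖ ≤ κ_s`, EVERY row-assigned line determinant between two leg
strings of arbitrary charges satisfies `‖det [contr C_{τ i} (X i) (Y l)]_{i,l<n}‖ ≤ (Σ_s κ_s²)^n` — no factorial in `n`.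
[cite: FeldmanKnorrerTrubowitz2004, App. B] -/
theorem norm_det_contr_le_of_gram (q : Γ → Bool) (C : ι → Matrix Γ Γ 𝕜) (hC : ∀ s X Y, q X = q Y → C s X Y = 0)
    (f g : ι → Γ → E) (κ : ι → ℝ) (hf : ∀ s X, q X = true → ‖f s X‖ ≤ κ s) (hg : ∀ s Y, q Y = false → ‖g s Y‖ ≤ κ s)
    (hG : ∀ s X Y, q X = true → q Y = false → contr 𝕜 (C s) X Y = ⟪f s X, g s Y⟫_𝕜)
    {n : ℕ} (τ : Fin n → ι) (X Y : Fin n → Γ) :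
    ‖(Matrix.of fun i l => contr 𝕜 (C (τ i)) (X i) (Y l)).det‖ ≤ (∑ s, κ s ^ 2) ^ n := by
  -- the line covariance and its charge map
  set Ct : Matrix (Γ × Option ι) (Γ × Option ι) 𝕜 := Matrix.of fun p p' : Γ × Option ι =>
    Option.elim p.2 (Option.elim p'.2 0 fun t => C t p.1 p'.1) fun t => Option.elim p'.2 (C t p.1 p'.1) fun _ => 0 with hCt
  set qt : Γ × Option ι → Bool := fun p => q p.1 with hqt
  -- the Gram vectors in `ℓ²(ι × Fin 2; E)`
  set ft : Γ × Option ι → PiLp 2 (fun _ : ι × Fin 2 => E) := fun p => WithLp.toLp 2 fun sc =>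
    Option.elim p.2 (if sc.2 = 1 then f sc.1 p.1 else 0) fun s => if sc.1 = s ∧ sc.2 = 0 then f s p.1 else 0 with hft
  set gt : Γ × Option ι → PiLp 2 (fun _ : ι × Fin 2 => E) := fun p => WithLp.toLp 2 fun sc =>
    Option.elim p.2 (if sc.2 = 0 then g sc.1 p.1 else 0) fun s => if sc.1 = s ∧ sc.2 = 1 then g s p.1 else 0 with hgt
  set K : ℝ := Real.sqrt (∑ s, κ s ^ 2) with hK
  have hK0 : 0 ≤ K := Real.sqrt_nonneg _
  have hKsq : K ^ 2 = ∑ s, κ s ^ 2 := Real.sq_sqrt (sum_nonneg fun s _ => sq_nonneg (κ s))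
  -- (1) `Ct` is charged for `qt`
  have hCt0 : ∀ p p', qt p = qt p' → Ct p p' = 0 := by
    rintro ⟨Z, o⟩ ⟨Z', o'⟩ hqq
    simp only [hqt] at hqq
    rcases o with _ | s <;> rcases o' with _ | s' <;>
      simp only [hCt, Matrix.of_apply, Option.elim_none, Option.elim_some, hC _ _ _ hqq]
  -- (2) the Gram form on the mixed pairs
  have hGt : ∀ p p', qt p = true → qt p' = false → contr 𝕜 Ct p p' = ⟪ft p, gt p'⟫_𝕜 := by
    rintro ⟨Z, o⟩ ⟨Z', o'⟩ hZ hZ'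
    simp only [hqt] at hZ hZ'
    rw [PiLp.inner_apply, Fintype.sum_prod_type]
    simp only [hft, hgt, PiLp.toLp_apply, Fin.sum_univ_two, Fin.isValue, one_ne_zero, zero_ne_one, and_true, and_false,
      if_false, if_true]
    rcases o with _ | s <;> rcases o' with _ | s'
    · simp only [hCt, contr_lineCov_none_none, Option.elim_none, inner_zero_left, inner_zero_right, add_zero, sum_const_zero]
    · simp only [hCt, contr_lineCov_none_some, Option.elim_none, Option.elim_some, inner_zero_left, zero_add, hG s' Z Z' hZ hZ']
      rw [Finset.sum_eq_single s' (fun t _ ht => by rw [if_neg ht, inner_zero_right]) (fun h => absurd (mem_univ _) h), if_pos rfl]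
    · simp only [hCt, contr_lineCov_some_none, Option.elim_none, Option.elim_some, inner_zero_right, add_zero, hG s Z Z' hZ hZ']
      rw [Finset.sum_eq_single s (fun t _ ht => by rw [if_neg ht, inner_zero_left]) (fun h => absurd (mem_univ _) h), if_pos rfl]
    · simp only [hCt, contr_lineCov_some_some, Option.elim_some, inner_zero_left, inner_zero_right, add_zero, sum_const_zero]
  -- (3) the norms of the Gram vectors
  have hnorm_f : ∀ p, qt p = true → ‖ft p‖ ≤ K := by
    rintro ⟨Z, o⟩ hZ
    simp only [hqt] at hZ
    rw [← Real.sqrt_sq (norm_nonneg _), hK]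
    refine Real.sqrt_le_sqrt ?_
    rw [PiLp.norm_sq_eq_of_L2, Fintype.sum_prod_type]
    simp only [hft, PiLp.toLp_apply, Fin.sum_univ_two, Fin.isValue, one_ne_zero, zero_ne_one, and_true, and_false, if_false,
      if_true]
    rcases o with _ | s
    · simp only [Option.elim_none, norm_zero, zero_pow two_ne_zero, zero_add]
      exact sum_ite_norm_sq_le _ fun t => hf t Z hZ
    · simp only [Option.elim_some, norm_zero, zero_pow two_ne_zero, add_zero]
      rw [Finset.sum_eq_single s (fun t _ ht => by rw [if_neg ht, norm_zero, zero_pow two_ne_zero]) (fun h => absurd (mem_univ _) h),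
        if_pos rfl]
      exact norm_sq_le_sum_sq s (hf s Z hZ)
  have hnorm_g : ∀ p, qt p = false → ‖gt p‖ ≤ K := by
    rintro ⟨Z, o⟩ hZ
    simp only [hqt] at hZ
    rw [← Real.sqrt_sq (norm_nonneg _), hK]
    refine Real.sqrt_le_sqrt ?_
    rw [PiLp.norm_sq_eq_of_L2, Fintype.sum_prod_type]
    simp only [hgt, PiLp.toLp_apply, Fin.sum_univ_two, Fin.isValue, one_ne_zero, zero_ne_one, and_true, and_false, if_false,
      if_true]
    rcases o with _ | s
    · simp only [Option.elim_none, norm_zero, zero_pow two_ne_zero, add_zero]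
      exact sum_ite_norm_sq_le _ fun t => hg t Z hZ
    · simp only [Option.elim_some, norm_zero, zero_pow two_ne_zero, zero_add]
      rw [Finset.sum_eq_single s (fun t _ ht => by rw [if_neg ht, norm_zero, zero_pow two_ne_zero]) (fun h => absurd (mem_univ _) h),
        if_pos rfl]
      exact norm_sq_le_sum_sq s (hg s Z hZ)
  -- (4) assemble
  rw [det_contr_eq_gaussExpect_lineCov, norm_mul, norm_pow, norm_neg, norm_one, one_pow, one_mul, ← hKsq, ← pow_mul,
    show 2 * n = n + n by ring]
  exact norm_gaussExpect_genProd_le qt Ct hCt0 ft gt hK0 hnorm_f hnorm_g hGt _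

end LineDeterminant

end Literature.MathematicalPhysics.QuantumLattice

end
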